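import Literature.NumberTheory.EllipticCurves.BSDRootNumberProofs
import Literature.NumberTheory.EllipticCurves.NewformsFrickeSignProofs
import Literature.NumberTheory.EllipticCurves.NewformsMainLemmaTraceProofs
import Literature.NumberTheory.Automorphic.BCDTModularity
import HarnessLib

/-!
# `Λ(E, 2 − s) = w(E) Λ(E, s)` for the chosen continuation (**bsd.S08**,
# `Literature.NumberTheory.EllipticCurves.completedLContinuation_two_sub`) from modularity alone
# (proofs for `BSDRootNumber.lean`, end of chain, continued)

D-0014 keeps `Literature/` sorry-free by stating cited results as named facts `def X : Prop`.
`BSDRootNumberTwoSubProofs` reduces the **bsd.S08** statement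

* for an elliptic curve `E/ℚ` given by `W`, `Λ(E, 2 − s) = w(E) Λ(E, s)` for all `s : ℂ`
  (`Λ(E, ·) = W.completedLContinuation N_E`, `w(E) = W.rootNumber`) — in Lean
  `∀ [W.IsElliptic] (s : ℂ), W.completedLContinuation (W.conductorNorm ℤ) (2 - s) =
  W.rootNumber * W.completedLContinuation (W.conductorNorm ℤ) s`; carried by the D-0014 sweep as
  a separate named fact `completedLContinuation_two_sub W` until the D-0026 review of 2026-08-15
  merged it into its provably equivalent continuation form
  `Literature.NumberTheory.EllipticCurves.completedLFunction_functional_equation W` (see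
  `BSDRootNumberTwoSubProofs`; the statement file now carries the outline theorem
  `completedLContinuation_two_sub (h : completedLFunction_functional_equation W)` again, and the
  theorems below conclude the unfolded statement) —

to a pair of named facts: `Literature.NumberTheory.EllipticCurves.ModularForms.exists_isNewformOf` (the Modularity Theorem:
Breuil–Conrad–Diamond–Taylor 2001, Thm. A, p. 843, "If `E/ℚ` is an elliptic curve, then `E` is
modular", in the form of condition (2) of their Introduction, "`L(E, s)` … equals … `L(f, s)` for
some eigenform `f` of weight `2` and level `N(E)`"; Diamond–Shurman Thm. 8.8.3) and
`Literature.ModularForms.atkinLehnerMainLemma0 N 2` for all `N` (Atkin–Lehner 1970, Thm. 1), by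
`completedLContinuation_two_sub_of_exists_isNewformOf_of_mainLemma0`.
The second member has since been **proved** in the tree
(`Literature.NumberTheory.EllipticCurves.ModularForms.atkinLehnerMainLemma0_holds`, `NewformsMainLemmaTraceProofs`). This file
records the consequences for the statement:

* `WeierstrassCurve.exists_hasFunctionalEquationSign_of_isNewformOf`,
  `WeierstrassCurve.hasFunctionalEquationSign_rootNumber_of_isNewformOf`,
  `Literature.NumberTheory.EllipticCurves.completedLContinuation_two_sub_of_isNewformOf`,
  `Literature.NumberTheory.EllipticCurves.completedLContinuation_two_sub_of_isModular`: **per curve** — if *this* `E` is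
  modular (there is a newform `f ∈ S₂(Γ₀(N_E))` with `aₙ(f) = aₙ(E)`, `IsNewformOf W f`;
  equivalently `Literature.BCDT.IsModular W`, BCDT, Introduction, condition (2)), then `Λ(E, s)` has an
  entire continuation with `Λ(E, 2 − s) = w(E) Λ(E, s)`, `w(E) = ±1`, unconditionally (Hecke's
  functional equation for `f`, `Λ_N(f, s) = i² ε_f Λ_N(f, 2 − s)`, being a theorem of the tree for
  newforms on `Γ₀(N)`: `IsNewform0.frickeFacts_of_mainLemma0` fed with
  `atkinLehnerMainLemma0_holds`). This is exactly the inference "BCDT Thm. A + Hecke" of the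
  fact's docstring, for one curve (Diamond–Shurman §8.8, after Thm. 8.8.3; Silverman AEC
  Thm. C.16.3).
* `Literature.NumberTheory.EllipticCurves.completedLContinuation_two_sub_of_exists_isNewformOf`: **the statement for every `W`
  from the Modularity Theorem `exists_isNewformOf` alone** — after this file its *only* unproved
  input in the tree.
* `Literature.NumberTheory.EllipticCurves.completedLContinuation_two_sub_of_theoremB_of_CDT`: the statement from the two deep inputs
  of BCDT's own proof of Theorem A in §2.2 as vendored in
  `Literature.NumberTheory.Automorphic.BCDTModularity` — Theorem B = Thm. 2.2.1
  (`Literature.NumberTheory.Automorphic.BCDT.theoremB`: every continuous absolutely irreducible `ρ̄ : G_ℚ → GL₂(𝔽₅)` with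
  cyclotomic determinant is modular) and Conrad–Diamond–Taylor 1999, Thm. 7.2.4
  (`Literature.NumberTheory.Automorphic.BCDT.CDT_theorem_7_2_4`), through `Literature.NumberTheory.Automorphic.BCDT.exists_isNewformOf_of_theoremB_of_CDT`
  (BCDT Thm. 2.2.2, proved there as printed).

No definitions and no new named facts are introduced; the statement is not weakened. (The file
imports `BSDRootNumberProofs` and `NewformsFrickeSignProofs` directly rather than
`BSDRootNumberTwoSubProofs`, whose reductions it re-derives in one line each, so that the two
sibling files are independent.) An unconditional proof for every `W` would be
`fun W ↦ completedLContinuation_two_sub_of_exists_isNewformOf W exists_isNewformOf_holds`, and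
`exists_isNewformOf_holds` is the Modularity Theorem.

## References

* C. Breuil, B. Conrad, F. Diamond, R. Taylor, *On the modularity of elliptic curves over `ℚ`:
  wild 3-adic exercises*, J. Amer. Math. Soc. 14 (2001), 843–939: Thm. A (p. 843), the equivalent
  conditions (1)–(6) of the Introduction, Thm. 2.2.1 = Thm. B and Thm. 2.2.2 (§2.2). [BCDTJAMS2001]
* B. Conrad, F. Diamond, R. Taylor, *Modularity of certain potentially Barsotti–Tate Galois
  representations*, J. Amer. Math. Soc. 12 (1999), 521–567, Thm. 7.2.4. [ConradDiamondTaylor1999]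
* A. O. L. Atkin, J. Lehner, *Hecke operators on `Γ₀(m)`*, Math. Ann. 185 (1970), 134–160,
  Thm. 1, Thm. 3. [AtkinLehner1970]
* F. Diamond, J. Shurman, *A first course in modular forms*, GTM 228 (2005), Thm. 5.10.2,
  Thm. 8.8.3 and the paragraph following it. [DiamondShurman2005]
* J. H. Silverman, *The Arithmetic of Elliptic Curves*, 2nd ed. (2009), App. C §16,
  Thm. C.16.3. [SilvermanAEC2009]
-/

noncomputable section

open scoped MatrixGroups

open CongruenceSubgroup Complex

/-! ### Hecke's functional equation for weight-`2` newforms is now a theorem of the tree -/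

namespace Literature.NumberTheory.EllipticCurves.ModularForms

/-- Hecke's functional equation with sign for newforms on `Γ₀(N)` in weight `2`, at every level —
the named fact `IsNewform0.exists_functional_equation (k := 2)` (for a newform `f` there is an
entire continuation `Λ` of `Λ_N(f, s)` with `Λ(s) = i² ε_f Λ(2 − s)`; Hecke 1936, Atkin–Lehner
1970 Thm. 3, Diamond–Shurman Thm. 5.10.2) — obtained from the proved Atkin–Lehner Main Lemma
`atkinLehnerMainLemma0_holds 2 N` (`NewformsMainLemmaTraceProofs`) through
`IsNewform0.frickeFacts_of_mainLemma0` (`NewformsFrickeSignProofs`). Recorded under a local name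
(the discharge `IsNewform0.exists_functional_equation_holds` belongs to that fact's own file).
[cite: AtkinLehner1970, Thm. 1 and Thm. 3] [cite: DiamondShurman2005, Thm. 5.10.2] -/
theorem IsNewform0.exists_functional_equation_two_of_mainLemma0_holds (N : ℕ) [NeZero N] :
    IsNewform0.exists_functional_equation (N := N) (k := 2) :=
  (IsNewform0.frickeFacts_of_mainLemma0 N 2 (atkinLehnerMainLemma0_holds 2 N)).2.2.2

end Literature.NumberTheory.EllipticCurves.ModularForms

/-! ### Per curve: a modular `E` satisfies the functional equation -/

namespace WeierstrassCurve

open Literature.NumberTheory.EllipticCurves.ModularForms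

variable (W : WeierstrassCurve ℚ)

/-- **A modular elliptic curve has a functional equation with sign `±1`, granted Hecke's
functional equation at its level.** If `f ∈ S₂(Γ₀(N_E))` is the newform attached to the elliptic
`W / ℚ` (`IsNewformOf W f`: `aₙ(f) = aₙ(E)` for all `n`; BCDT, Introduction, condition (2)) and
newforms of weight `2` and level `N_E` satisfy Hecke's functional equation
(`IsNewform0.exists_functional_equation`), then for the entire continuation `Λ` of
`Λ_{N_E}(f, s)` one has `Λ ∈ W.completedLContinuations N_E`
(`IsNewformOf.completedLFunction_eq_holds`) and `Λ(2 − s) = (i² ε_f) Λ(s)` with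
`i² ε_f = (−1)^{r_an} = ±1` (`eq_neg_one_pow_analyticRank_of_mem_completedLContinuations`); so
`W.HasFunctionalEquationSign ε` for an integer `ε = ±1`. This is
`exists_hasFunctionalEquationSign_of_modularity` of `BSDRootNumberProofs` with its global
modularity hypothesis replaced by modularity of `W` alone (same proof).
[cite: DiamondShurman2005, Thm. 5.10.2 and Thm. 8.8.3]
[cite: BCDTJAMS2001, Introduction, condition (2)] -/
theorem exists_hasFunctionalEquationSign_of_isNewformOf_of_exists_functional_equation
    [W.IsElliptic] [NeZero (W.conductorNorm ℤ)] {f : CuspForm (Gamma0 (W.conductorNorm ℤ)) 2}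
    (hf : IsNewformOf W f)
    (hfe : IsNewform0.exists_functional_equation (N := W.conductorNorm ℤ) (k := 2)) :
    ∃ ε : ℤ, W.HasFunctionalEquationSign ε := by
  obtain ⟨Λ, hΛ, hΛfe⟩ := hfe hf.1
  have hmem : Λ ∈ W.completedLContinuations (W.conductorNorm ℤ) := by
    refine ⟨hΛ.1, fun s hs ↦ ?_⟩
    refine IsNewformOf.completedLFunction_eq_holds hf hΛ fun n hn ↦ ?_
    rw [hn] at hs
    simp only [neg_re, natCast_re] at hs
    linarith [n.cast_nonneg (α := ℝ)]
  have hfe' : ∀ s : ℂ, Λ (2 - s) = (Complex.I ^ (2 : ℤ) * frickeEigenvalue f) * Λ s := fun s ↦ by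
    have h := hΛfe (2 - s)
    rwa [show (((2 : ℤ) : ℂ) - (2 - s)) = s by push_cast; ring] at h
  have hη := eq_neg_one_pow_analyticRank_of_mem_completedLContinuations hmem hfe'
  rcases neg_one_pow_eq_or ℂ W.analyticRank with h2 | h2
  · refine ⟨1, Λ, hmem, fun s ↦ ?_⟩
    rw [hfe', hη, h2]
    push_cast
    ring
  · refine ⟨-1, Λ, hmem, fun s ↦ ?_⟩
    rw [hfe', hη, h2]
    push_cast
    ring

/-- **A modular elliptic curve has a functional equation with sign `±1`** (unconditionally in
the present tree): if `f ∈ S₂(Γ₀(N_E))` is the newform attached to the elliptic `W / ℚ`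
(`IsNewformOf W f`), then `W.HasFunctionalEquationSign ε` for some integer `ε` — Hecke's
functional equation for `f` being supplied by
`IsNewform0.exists_functional_equation_two_of_mainLemma0_holds` (Atkin–Lehner Main Lemma, proved).
"BCDT Thm. A + Hecke" for one curve: Diamond–Shurman §8.8 (after Thm. 8.8.3), Silverman AEC
Thm. C.16.3. [cite: DiamondShurman2005, Thm. 5.10.2 and Thm. 8.8.3]
[cite: SilvermanAEC2009, App. C §16, Thm. C.16.3] -/
theorem exists_hasFunctionalEquationSign_of_isNewformOf [W.IsElliptic]
    [NeZero (W.conductorNorm ℤ)] {f : CuspForm (Gamma0 (W.conductorNorm ℤ)) 2}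
    (hf : IsNewformOf W f) : ∃ ε : ℤ, W.HasFunctionalEquationSign ε :=
  W.exists_hasFunctionalEquationSign_of_isNewformOf_of_exists_functional_equation hf
    (IsNewform0.exists_functional_equation_two_of_mainLemma0_holds _)

/-- **`Λ(E, 2 − s) = w(E) Λ(E, s)` for a modular `E`**: the prelude fact
`W.hasFunctionalEquationSign_rootNumber` (functional equation of an entire continuation at level
`N_E` with sign the analytic root number `w(E) = ±1`) for every `W` carrying a newform
`f ∈ S₂(Γ₀(N_E))` with `aₙ(f) = aₙ(E)` (`IsNewformOf W f`). The sign of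
`exists_hasFunctionalEquationSign_of_isNewformOf` is `w(E)` by
`hasFunctionalEquationSign_rootNumber_of_exists` (Silverman AEC Thm. C.16.3: "*the* sign of the
functional equation"). [cite: SilvermanAEC2009, App. C §16, Thm. C.16.3]
[cite: BCDTJAMS2001, Introduction, condition (2)] -/
theorem hasFunctionalEquationSign_rootNumber_of_isNewformOf [NeZero (W.conductorNorm ℤ)]
    {f : CuspForm (Gamma0 (W.conductorNorm ℤ)) 2} (hf : IsNewformOf W f) :
    W.hasFunctionalEquationSign_rootNumber := by
  intro _
  exact hasFunctionalEquationSign_rootNumber_of_exists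
    (W.exists_hasFunctionalEquationSign_of_isNewformOf hf)

end WeierstrassCurve

namespace Literature.NumberTheory.EllipticCurves

open ModularForms

/-- **bsd.S08 `Λ(E, 2 − s) = w(E) Λ(E, s)` (chosen continuation) for a modular `W`.** If `f ∈ S₂(Γ₀(N_E))` is
the newform attached to `W` (`IsNewformOf W f`, i.e. `aₙ(f) = aₙ(E)` for all `n`: BCDT 2001,
Introduction, condition (2), "`L(E, s) = L(f, s)` for some eigenform `f` of weight `2` and level
`N(E)`"), then the chosen continuation `Λ(E, ·) = W.completedLContinuation N_E` satisfies
`Λ(E, 2 − s) = w(E) Λ(E, s)` for all `s` (from `hasFunctionalEquationSign_rootNumber_of_isNewformOf`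
and the theorem `completedLContinuation_two_sub` of the statement file `BSDRootNumber`: uniqueness
of the entire continuation).
[cite: BCDTJAMS2001, Thm. A and Introduction, condition (2)]
[cite: SilvermanAEC2009, App. C §16, Thm. C.16.3] -/
theorem completedLContinuation_two_sub_of_isNewformOf (W : WeierstrassCurve ℚ)
    [NeZero (W.conductorNorm ℤ)] {f : CuspForm (Gamma0 (W.conductorNorm ℤ)) 2}
    (hf : IsNewformOf W f) [W.IsElliptic] (s : ℂ) :
    W.completedLContinuation (W.conductorNorm ℤ) (2 - s) =
      W.rootNumber * W.completedLContinuation (W.conductorNorm ℤ) s :=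
  completedLContinuation_two_sub W (W.hasFunctionalEquationSign_rootNumber_of_isNewformOf hf) s

/-- **bsd.S08 `Λ(E, 2 − s) = w(E) Λ(E, s)` (chosen continuation) for a modular `W`, BCDT
phrasing**: if `E` is
modular in the sense of Breuil–Conrad–Diamond–Taylor (`Literature.BCDT.IsModular W`: a newform
`f ∈ S₂(Γ₀(N_E))` is attached to `W`; BCDT, Introduction, condition (2)), then
`Λ(E, 2 − s) = w(E) Λ(E, s)`. [cite: BCDTJAMS2001, Thm. A and Introduction, condition (2)] -/
theorem completedLContinuation_two_sub_of_isModular (W : WeierstrassCurve ℚ)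
    [NeZero (W.conductorNorm ℤ)] (h : Literature.NumberTheory.Automorphic.BCDT.IsModular W)
    [W.IsElliptic] (s : ℂ) :
    W.completedLContinuation (W.conductorNorm ℤ) (2 - s) =
      W.rootNumber * W.completedLContinuation (W.conductorNorm ℤ) s := by
  obtain ⟨f, hf⟩ := h
  exact completedLContinuation_two_sub_of_isNewformOf W hf s

/-! ### The fact from the Modularity Theorem alone -/

/-- **bsd.S08 `Λ(E, 2 − s) = w(E) Λ(E, s)` (chosen continuation) from the Modularity Theorem
alone.** Granted the
named fact `Literature.NumberTheory.EllipticCurves.ModularForms.exists_isNewformOf` — every elliptic `E/ℚ` has a newform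
`f ∈ S₂(Γ₀(N_E))` with `aₙ(f) = aₙ(E)` (Breuil–Conrad–Diamond–Taylor 2001, Thm. A, p. 843, "If
`E/ℚ` is an elliptic curve, then `E` is modular", with "modular" in the form of condition (2) of
their Introduction; level `N(E)` by Carayol; Diamond–Shurman Thm. 8.8.3) — the chosen
continuation of every elliptic `W` satisfies `Λ(E, 2 − s) = w(E) Λ(E, s)`
(`completedLFunction_functional_equation_of_modularity` of `BSDRootNumberProofs` and the theorem
`completedLContinuation_two_sub` of the statement file `BSDRootNumber`). The Hecke/Atkin–Lehner
input of
`completedLContinuation_two_sub_of_modularity` and `…_of_exists_isNewformOf_of_mainLemma0`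
(`BSDRootNumberTwoSubProofs`) is discharged by
`IsNewform0.exists_functional_equation_two_of_mainLemma0_holds` (`atkinLehnerMainLemma0_holds 2`,
`NewformsMainLemmaTraceProofs`); modularity is the only remaining unproved input of the statement.
[cite: BCDTJAMS2001, Thm. A] -/
theorem completedLContinuation_two_sub_of_exists_isNewformOf (W : WeierstrassCurve ℚ)
    (hmod : exists_isNewformOf) [W.IsElliptic] (s : ℂ) :
    W.completedLContinuation (W.conductorNorm ℤ) (2 - s) =
      W.rootNumber * W.completedLContinuation (W.conductorNorm ℤ) s :=
  completedLContinuation_two_sub W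
    (completedLFunction_functional_equation_of_modularity W hmod
      fun N _ ↦ IsNewform0.exists_functional_equation_two_of_mainLemma0_holds N) s

/-- The same from the `∃!` form `Literature.NumberTheory.EllipticCurves.ModularForms.existsUnique_isNewformOf` of the Modularity
Theorem (uniqueness of the newform is the `q`-expansion principle,
`existsUnique_isNewformOf_iff`). [cite: BCDTJAMS2001, Thm. A] -/
theorem completedLContinuation_two_sub_of_existsUnique_isNewformOf' (W : WeierstrassCurve ℚ)
    (hmod : existsUnique_isNewformOf) [W.IsElliptic] (s : ℂ) :
    W.completedLContinuation (W.conductorNorm ℤ) (2 - s) =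
      W.rootNumber * W.completedLContinuation (W.conductorNorm ℤ) s :=
  completedLContinuation_two_sub_of_exists_isNewformOf W (exists_isNewformOf_of_existsUnique hmod) s

/-- **The trust base of bsd.S08 in the tree is the Modularity Theorem**: the conjunction over
every `W` of "`Λ(E, 2 − s) = w(E) Λ(E, s)` for the chosen continuation" follows from
`exists_isNewformOf` (BCDT 2001, Thm. A). (The converse direction is not claimed: the functional
equation of `L(E, s)` alone does not give modularity — Weil's converse theorem needs the twisted
functional equations.) [cite: BCDTJAMS2001, Thm. A] -/
theorem forall_completedLContinuation_two_sub_of_exists_isNewformOf (hmod : exists_isNewformOf) :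
    ∀ (W : WeierstrassCurve ℚ) [W.IsElliptic] (s : ℂ),
      W.completedLContinuation (W.conductorNorm ℤ) (2 - s) =
        W.rootNumber * W.completedLContinuation (W.conductorNorm ℤ) s :=
  fun W _ s ↦ completedLContinuation_two_sub_of_exists_isNewformOf W hmod s

/-! ### The fact from the inputs of BCDT's proof of Theorem A (§2.2) -/

/-- **bsd.S08 `Λ(E, 2 − s) = w(E) Λ(E, s)` (chosen continuation) from BCDT Theorem B and CDT
Theorem 7.2.4.**
Breuil–Conrad–Diamond–Taylor prove Theorem A in §2.2 as Thm. 2.2.2 ("Every elliptic curve defined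
over the rational numbers is modular") by combining their Thm. 2.2.1 = Theorem B (every
continuous absolutely irreducible `ρ̄ : G_ℚ → GL₂(𝔽₅)` with cyclotomic determinant is modular;
the named fact `Literature.NumberTheory.Automorphic.BCDT.theoremB`) with Conrad–Diamond–Taylor 1999, Thm. 7.2.4 (if `ρ̄_{E,5}` is
modular or `ρ̄_{E,5}|_{ℚ(√5)}` is absolutely reducible then `E` is modular; the named fact
`Literature.NumberTheory.Automorphic.BCDT.CDT_theorem_7_2_4`); that deduction is proved in the tree
(`Literature.NumberTheory.Automorphic.BCDT.exists_isNewformOf_of_theoremB_of_CDT`, the determinant `det ρ̄_{E,5} = χ̄₅` coming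
from the Weil pairing). Hence the functional equation of `Λ(E, s)` for every elliptic `E/ℚ` from
exactly these two named facts. [cite: BCDTJAMS2001, Thm. 2.2.1 and Thm. 2.2.2]
[cite: ConradDiamondTaylor1999, Thm. 7.2.4] -/
theorem completedLContinuation_two_sub_of_theoremB_of_CDT (hB : Literature.NumberTheory.Automorphic.BCDT.theoremB)
    (hCDT : Literature.NumberTheory.Automorphic.BCDT.CDT_theorem_7_2_4) (W : WeierstrassCurve ℚ)
    [W.IsElliptic] (s : ℂ) :
    W.completedLContinuation (W.conductorNorm ℤ) (2 - s) =
      W.rootNumber * W.completedLContinuation (W.conductorNorm ℤ) s :=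
  completedLContinuation_two_sub_of_exists_isNewformOf W
    (Literature.NumberTheory.Automorphic.BCDT.exists_isNewformOf_of_theoremB_of_CDT hB hCDT) s

end Literature.NumberTheory.EllipticCurves

end
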